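import Literature.AnabelianGeometry.AbsoluteAnabelian.AbsTopIII.KummerCurveLawsNonVacuity
import Literature.AnabelianGeometry.AbsoluteAnabelian.SubpadicExamples
import Mathlib.FieldTheory.RatFunc.AsPolynomial
import HarnessLib

/-!
# [AbsTopIII] Prop. 1.6 (i), (iii), Prop. 1.8 (i), (ii) as the schemata
# `IntrinsicKummerModel.Prop_1_6_i / Prop_1_6_iii_units / Prop_1_8_i_units / Prop_1_8_ii_units`
# (FACT-LIST F-0374 – F-0377): the universal closures hold iff NO Kummer-faithful field exists

S. Mochizuki, *Topics in absolute anabelian geometry III: global reconstruction algorithms*,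
J. Math. Sci. Univ. Tokyo 22 (2015) [MochizukiAbsTopIII2015]; manuscript pages
(`paper:url-5493eb38cbb7`): Prop. 1.6 (i) p. 34, (iii) p. 35; Prop. 1.8 (i), (ii) p. 36.

PROOF-ONLY negative-knowledge file (no definition, no instance) next to `AbsTopIII/KummerIntrinsic.lean`
(abc-iut-L4-t1); abc-iut cell seat abc-iut-f-084 (FACT-LIST rows **F-0374** `Prop_1_6_i`, **F-0375**
`Prop_1_6_iii_units`, **F-0376** `Prop_1_8_i_units`, **F-0377** `Prop_1_8_ii_units`, all of class
`preparatory`, kernel_closedness `parametrised`).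

The four rows are NAMED FACTS RELATIVE TO A MODEL `M : IntrinsicKummerModel` (typing policy θ of the
interface owner): the interface records, for an index type of curves, the base field, the extension
`1 → Δ → Π → G → 1`, cusps, points, the function field, the orders `ord_x` and a FREE field
`kummerMap` ("the associated Kummer map `κ_U : Γ(U, 𝒪_U^×) → H¹(Π_U, M_X)`", Prop. 1.6 p. 34), and each
`Prop_…` says that THIS model's Kummer map behaves as print asserts for the étale-`π₁` model, under the
guard `IsKummerFaithful (M.base U)`.  Their consumers (`Thm19KummerTowerProofs`,
`Thm19KummerContainerInjProofs`, `Thm19KummerContainerPartsProofs`, `Thm19KummerContainerEmbeddingProofs`,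
`Thm19KummerTowerDictionaryProofs`) take them as hypotheses `(h16 : M.Prop_1_6_i)` … at a VARIABLE `M`.

This file supplies the kernel objects deciding the UNIVERSAL CLOSURES `∀ M, M.Prop_…`:

* `IntrinsicKummerModel.exists_model_props_iff_not_isKummerFaithful` — for every field `k` of
  characteristic zero there is an explicit model `M_k` (one proper curve; `Π = G = Gal(k̄/k)`, `Δ = 1`;
  no cusps; one closed point with `D_x = 1`; `K_U = k(X) = RatFunc k`; `ord ≡ 0`; `κ_U ≡ 0`; all
  NF-predicates `True` except `IsNFConstant ≡ False`) at which EACH of the four schemata is EQUIVALENT to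
  `¬ IsKummerFaithful k` (the indeterminate `X` is a nonconstant regular unit with trivial Kummer class);
* `forall_prop_1_6_i_iff` (and `_1_6_iii_units`, `_1_8_i_units`, `_1_8_ii_units`):
  `(∀ M, M.Prop_…) ↔ ∀ k, ¬ IsKummerFaithful k` — the closed schema holds iff Kummer-faithful fields
  (Def. 1.5 p. 32, tree predicate `IsKummerFaithful`) do not exist in the universe;
* `not_forall_prop_…_of_isKummerFaithful` — hence REFUTED by any one Kummer-faithful field, and
  `not_forall_prop_…_of_rmk154i` — REFUTED (universe `0`, at `k = ℚ`, sub-`p`-adic by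
  `IsSubpadic.of_isNF`) modulo the FACT-LIST row F-0369 `Rmk_1_5_4_i` ("sub-`p`-adic ⟹ Kummer-faithful",
  Rmk. 1.5.4 (i) p. 33): the closed schemata F-0374 – F-0377 and F-0369 are JOINTLY INCONSISTENT, so none
  of the four may appear as a closed hypothesis binder of a conditional certificate next to F-0369;
* `prop_…_of_isEmpty_curve` — the instance forms hold (DEGENERATELY) at every model with no curves
  (`IntrinsicKummerModel.exists_isEmpty_curve`, `KummerCurveLawsNonVacuity.lean`), the only constructed
  models in the tree (no étale `π₁`).

So F-0374 – F-0377 are admissible ONLY in their instance form — as hypotheses on the particular model a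
consumer quantifies over (FACT-LIST class «universal-closure REFUTED (modulo F-0369) / schema; instance
forms = per-model hypotheses»).  Refereed pre-IUT material; refuted-as-schema is not a defect of print,
whose statements concern the étale fundamental group; nothing here bears on [IUTchIII] Cor. 3.12 or takes
a side.
-/

noncomputable section

open CategoryTheory

universe u

namespace Literature.AnabelianGeometry.AbsoluteAnabelian.AbsTopIII

namespace IntrinsicKummerModel

/-! ### Two facts about `k(X)` -/

/-- The indeterminate `X ∈ k(X)` is not a constant: `X ∉ k ⊆ k(X)`.
[cite: MochizukiAbsTopIII2015, Prop 1.6 (iii) p.35] -/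
theorem ratFuncX_not_mem_range_algebraMap (k : Type u) [Field k] :
    (RatFunc.X : RatFunc k) ∉ Set.range (algebraMap k (RatFunc k)) := by
  rintro ⟨c, hc⟩
  rw [RatFunc.algebraMap_eq_C] at hc
  have h := congrArg RatFunc.num hc
  rw [RatFunc.num_C, RatFunc.num_X] at h
  exact Polynomial.X_ne_C c h.symm

/-- `X ≠ 1` in `k(X)`. [cite: MochizukiAbsTopIII2015, Prop 1.6 (i) p.34] -/
theorem ratFuncX_ne_one (k : Type u) [Field k] : (RatFunc.X : RatFunc k) ≠ 1 := fun h =>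
  ratFuncX_not_mem_range_algebraMap k ⟨1, by rw [map_one, h]⟩

/-! ### The test model `M_k` -/

/-- **The test model.**  For every field `k` of characteristic zero there is a model
`M : IntrinsicKummerModel` — ONE curve `U = X` declared proper, scheme-like, of genus `2`, an NF-curve,
over `k`; extension `Π = G = Gal(k̄/k)` (identity augmentation, `Δ = 1`); no cusps; one closed point, an
NF-point, with decomposition group `1`, not `k`-rational; function field `K_U = k(X)`; `ord ≡ 0` (so
`Γ(U, 𝒪_U^×) = k(X)^×`); every rational function NF-rational, no NF-constants; and the TRIVIAL Kummer map
`κ_U ≡ 0` — at which each of the four schemata `Prop_1_6_i`, `Prop_1_6_iii_units`, `Prop_1_8_i_units`,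
`Prop_1_8_ii_units` is equivalent to `¬ IsKummerFaithful k`: if `k` is Kummer-faithful the guards are met
and the nonconstant regular unit `X` (Kummer class `0 = κ_U(1)`, all restrictions `0`) violates each
conclusion; if not, each holds vacuously. [cite: MochizukiAbsTopIII2015, Prop 1.6 (i) p.34] -/
theorem exists_model_props_iff_not_isKummerFaithful (k : Type u) [Field k] [CharZero k] :
    ∃ M : IntrinsicKummerModel.{u},
      (M.Prop_1_6_i ↔ ¬ IsKummerFaithful k) ∧ (M.Prop_1_6_iii_units ↔ ¬ IsKummerFaithful k) ∧
        (M.Prop_1_8_i_units ↔ ¬ IsKummerFaithful k) ∧ (M.Prop_1_8_ii_units ↔ ¬ IsKummerFaithful k) := by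
  -- the extension `Π = G = Gal(k̄/k)`, `aug = id`
  let E : FundamentalExtension.{u} :=
    { arith := absoluteGaloisGrp k, gal := absoluteGaloisGrp k
      aug := ContinuousMonoidHom.id _, aug_surjective := Function.surjective_id }
  -- no cusps
  let C : E.CuspidalData :=
    { Cusp := PEmpty.{u + 1}, Dcusp := fun x => x.elim, Icusp := fun x => x.elim
      Icusp_eq := fun x => x.elim, isClosed_Dcusp := fun x => x.elim, eq_of_conj := fun x => x.elim }
  let M : IntrinsicKummerModel.{u} :=
    { Curve := PUnit.{u + 2}
      base := fun _ => k
      instField := fun _ => inferInstanceAs (Field k)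
      instCharZero := fun _ => inferInstanceAs (CharZero k)
      ext := fun _ => E
      galIso := fun _ => Iso.refl _
      cusps := fun _ => C
      IsProper := fun _ => True
      IsScheme := fun _ => True
      genus := fun _ => 2
      FunctionField := fun _ => RatFunc k
      instFunctionField := fun _ => inferInstanceAs (Field (RatFunc k))
      instAlgebra := fun _ => inferInstanceAs (Algebra k (RatFunc k))
      Point := fun _ => PUnit.{u + 1}
      decomp := fun _ _ => ⊥
      IsNFCurve := fun _ => True
      IsNFPoint := fun _ _ => True
      IsNFRational := fun _ _ => True
      IsNFConstant := fun _ _ => False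
      NFFunctionField := fun _ => RatFunc k
      instNFFunctionField := fun _ => inferInstanceAs (Field (RatFunc k))
      IsStrictlyBelyiType := fun _ => True
      IsCofiniteOpen := fun _ _ => True
      res := fun _ => 𝟙 E
      IsRationalPt := fun _ _ => False
      ptSection := fun _ h => h.elim
      ptSection_range := fun _ h => h.elim
      ord := fun _ => 1
      kummerMap := fun _ _ => 1 }
  -- the nonconstant regular unit `X ∈ Γ(U, 𝒪_U^×) = k(X)^×`
  let Xu : M.regularUnits PUnit.unit :=
    ⟨Units.mk0 RatFunc.X RatFunc.X_ne_zero, (M.mem_regularUnits _).2 fun _ => rfl⟩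
  have hXnc : ¬ M.IsConstantUnit (Xu : (M.FunctionField PUnit.unit)ˣ) :=
    ratFuncX_not_mem_range_algebraMap k
  have hg : 2 ≤ M.genus PUnit.unit := le_rfl
  have hcusp : ∀ c : (M.cusps PUnit.unit).Cusp, (M.cusps PUnit.unit).IsRational c := fun c => c.elim
  -- every Kummer restriction vanishes (`κ_U ≡ 0`)
  have hres : ∀ (D : Subgroup (M.ext PUnit.unit).arith) (f : M.regularUnits PUnit.unit),
      M.kummerRes (U := PUnit.unit) (X := PUnit.unit) trivial trivial D f = 0 := by
    intro D f
    change (cyclotomeModH1Res (M.res (U := PUnit.unit) (U' := PUnit.unit) trivial) ZHatCoeff.{u} D)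
      0 = 0
    exact map_zero _
  refine ⟨M, ⟨fun H hk => ?_, fun hk _ _ _ _ _ _ _ h => absurd h hk⟩,
    ⟨fun H hk => ?_, fun hk _ _ _ _ _ _ _ h => absurd h hk⟩,
    ⟨fun H hk => ?_, fun hk _ _ _ _ _ _ _ h => absurd h hk⟩,
    ⟨fun H hk => ?_, fun hk _ _ _ _ _ _ _ h => absurd h hk⟩⟩
  · -- Prop. 1.6 (i): `κ_U ≡ 0` is not injective (`X ≠ 1`)
    have h1 : (1 : M.regularUnits PUnit.unit) = Xu := by
      apply H PUnit.unit PUnit.unit trivial trivial trivial trivial hg hk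
      rfl
    exact ratFuncX_ne_one k
      (congrArg (fun f : M.regularUnits PUnit.unit => ((f : (RatFunc k)ˣ) : RatFunc k)) h1).symm
  · -- Prop. 1.6 (iii): all cuspidal restrictions of `κ_U(X)` vanish (no cusps), yet `X` is not constant
    exact hXnc ((H PUnit.unit PUnit.unit trivial trivial trivial trivial hg hk hcusp Xu).1
      fun c => c.elim)
  · -- Prop. 1.8 (i): `X` is NF-rational and nonconstant, yet no multiple of `κ_U(X)|_{x₂} = 0` is `≠ 0`
    obtain ⟨n, -, x₁, x₂, -, -, -, hne⟩ :=
      (H PUnit.unit PUnit.unit trivial trivial trivial trivial hg hk hcusp trivial Xu).1 ⟨trivial, hXnc⟩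
    exact hne (by rw [hres, smul_zero])
  · -- Prop. 1.8 (ii): `1 ∈ k^×` is not an NF-constant (none are), yet `κ_U(X)|_x = 0 = κ_U(1)|_x`
    exact (H PUnit.unit PUnit.unit trivial trivial trivial trivial hg hk hcusp trivial
      ⟨Xu, trivial, hXnc⟩ 1 ((M.mem_regularUnits _).2 fun _ => rfl)).2
        ⟨Xu, PUnit.unit, trivial, hXnc, trivial, by rw [hres, hres]⟩

/-! ### The universal closures, decided -/

/-- **F-0374 as a closed schema**: `Prop_1_6_i` holds at EVERY model iff there is NO Kummer-faithful field
(in the universe). [cite: MochizukiAbsTopIII2015, Prop 1.6 (i) p.34] -/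
theorem forall_prop_1_6_i_iff :
    (∀ M : IntrinsicKummerModel.{u},
        Literature.AnabelianGeometry.AbsoluteAnabelian.AbsTopIII.IntrinsicKummerModel.Prop_1_6_i M) ↔
      ∀ (k : Type u) [Field k], ¬ IsKummerFaithful k := by
  refine ⟨fun H k _ hk => ?_, fun H M U X h hX _ _ _ hk => absurd hk (H _)⟩
  haveI : CharZero k := hk.torally.charZero
  obtain ⟨M, h, -, -, -⟩ := exists_model_props_iff_not_isKummerFaithful k
  exact h.1 (H M) hk

/-- **F-0375 as a closed schema**: `Prop_1_6_iii_units` holds at EVERY model iff there is NO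
Kummer-faithful field. [cite: MochizukiAbsTopIII2015, Prop 1.6 (iii) p.35] -/
theorem forall_prop_1_6_iii_units_iff :
    (∀ M : IntrinsicKummerModel.{u},
        Literature.AnabelianGeometry.AbsoluteAnabelian.AbsTopIII.IntrinsicKummerModel.Prop_1_6_iii_units
          M) ↔
      ∀ (k : Type u) [Field k], ¬ IsKummerFaithful k := by
  refine ⟨fun H k _ hk => ?_, fun H M U X h hX _ _ _ hk => absurd hk (H _)⟩
  haveI : CharZero k := hk.torally.charZero
  obtain ⟨M, -, h, -, -⟩ := exists_model_props_iff_not_isKummerFaithful k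
  exact h.1 (H M) hk

/-- **F-0376 as a closed schema**: `Prop_1_8_i_units` holds at EVERY model iff there is NO
Kummer-faithful field. [cite: MochizukiAbsTopIII2015, Prop 1.8 (i) p.36] -/
theorem forall_prop_1_8_i_units_iff :
    (∀ M : IntrinsicKummerModel.{u},
        Literature.AnabelianGeometry.AbsoluteAnabelian.AbsTopIII.IntrinsicKummerModel.Prop_1_8_i_units
          M) ↔
      ∀ (k : Type u) [Field k], ¬ IsKummerFaithful k := by
  refine ⟨fun H k _ hk => ?_, fun H M U X h hX _ _ _ hk => absurd hk (H _)⟩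
  haveI : CharZero k := hk.torally.charZero
  obtain ⟨M, -, -, h, -⟩ := exists_model_props_iff_not_isKummerFaithful k
  exact h.1 (H M) hk

/-- **F-0377 as a closed schema**: `Prop_1_8_ii_units` holds at EVERY model iff there is NO
Kummer-faithful field. [cite: MochizukiAbsTopIII2015, Prop 1.8 (ii) p.36] -/
theorem forall_prop_1_8_ii_units_iff :
    (∀ M : IntrinsicKummerModel.{u},
        Literature.AnabelianGeometry.AbsoluteAnabelian.AbsTopIII.IntrinsicKummerModel.Prop_1_8_ii_units
          M) ↔
      ∀ (k : Type u) [Field k], ¬ IsKummerFaithful k := by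
  refine ⟨fun H k _ hk => ?_, fun H M U X h hX _ _ _ hk => absurd hk (H _)⟩
  haveI : CharZero k := hk.torally.charZero
  obtain ⟨M, -, -, -, h⟩ := exists_model_props_iff_not_isKummerFaithful k
  exact h.1 (H M) hk

/-! ### Refutations modulo one Kummer-faithful field / modulo F-0369 -/

/-- **F-0374, universal closure REFUTED by any Kummer-faithful field.**
[cite: MochizukiAbsTopIII2015, Prop 1.6 (i) p.34] -/
theorem not_forall_prop_1_6_i_of_isKummerFaithful {k : Type u} [Field k] (hk : IsKummerFaithful k) :
    ¬ ∀ M : IntrinsicKummerModel.{u},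
        Literature.AnabelianGeometry.AbsoluteAnabelian.AbsTopIII.IntrinsicKummerModel.Prop_1_6_i M :=
  fun H => forall_prop_1_6_i_iff.1 H k hk

/-- **F-0375, universal closure REFUTED by any Kummer-faithful field.**
[cite: MochizukiAbsTopIII2015, Prop 1.6 (iii) p.35] -/
theorem not_forall_prop_1_6_iii_units_of_isKummerFaithful {k : Type u} [Field k]
    (hk : IsKummerFaithful k) :
    ¬ ∀ M : IntrinsicKummerModel.{u},
        Literature.AnabelianGeometry.AbsoluteAnabelian.AbsTopIII.IntrinsicKummerModel.Prop_1_6_iii_units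
          M :=
  fun H => forall_prop_1_6_iii_units_iff.1 H k hk

/-- **F-0376, universal closure REFUTED by any Kummer-faithful field.**
[cite: MochizukiAbsTopIII2015, Prop 1.8 (i) p.36] -/
theorem not_forall_prop_1_8_i_units_of_isKummerFaithful {k : Type u} [Field k]
    (hk : IsKummerFaithful k) :
    ¬ ∀ M : IntrinsicKummerModel.{u},
        Literature.AnabelianGeometry.AbsoluteAnabelian.AbsTopIII.IntrinsicKummerModel.Prop_1_8_i_units
          M :=
  fun H => forall_prop_1_8_i_units_iff.1 H k hk

/-- **F-0377, universal closure REFUTED by any Kummer-faithful field.**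
[cite: MochizukiAbsTopIII2015, Prop 1.8 (ii) p.36] -/
theorem not_forall_prop_1_8_ii_units_of_isKummerFaithful {k : Type u} [Field k]
    (hk : IsKummerFaithful k) :
    ¬ ∀ M : IntrinsicKummerModel.{u},
        Literature.AnabelianGeometry.AbsoluteAnabelian.AbsTopIII.IntrinsicKummerModel.Prop_1_8_ii_units
          M :=
  fun H => forall_prop_1_8_ii_units_iff.1 H k hk

/-- `ℚ` is Kummer-faithful modulo F-0369 `Rmk_1_5_4_i` ("sub-`p`-adic ⟹ Kummer-faithful", Rmk. 1.5.4 (i)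
p. 33; number fields are sub-`p`-adic, `IsSubpadic.of_isNF`). [cite: MochizukiAbsTopIII2015, Rmk 1.5.4 (i) p.33] -/
theorem isKummerFaithful_rat_of_rmk154i
    (h : Literature.AnabelianGeometry.AbsoluteAnabelian.AbsTopIII.Rmk_1_5_4_i.{0}) :
    IsKummerFaithful ℚ :=
  h ℚ (IsSubpadic.of_isNF ⟨inferInstance⟩)

/-- **F-0374, universal closure REFUTED modulo F-0369** (universe `0`, at `k = ℚ`): the closed schemata
`Rmk_1_5_4_i` and `∀ M, M.Prop_1_6_i` are jointly inconsistent. [cite: MochizukiAbsTopIII2015, Prop 1.6 (i) p.34] -/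
theorem not_forall_prop_1_6_i_of_rmk154i
    (h : Literature.AnabelianGeometry.AbsoluteAnabelian.AbsTopIII.Rmk_1_5_4_i.{0}) :
    ¬ ∀ M : IntrinsicKummerModel.{0},
        Literature.AnabelianGeometry.AbsoluteAnabelian.AbsTopIII.IntrinsicKummerModel.Prop_1_6_i M :=
  not_forall_prop_1_6_i_of_isKummerFaithful (isKummerFaithful_rat_of_rmk154i h)

/-- **F-0375, universal closure REFUTED modulo F-0369** (universe `0`, at `k = ℚ`).
[cite: MochizukiAbsTopIII2015, Prop 1.6 (iii) p.35] -/
theorem not_forall_prop_1_6_iii_units_of_rmk154i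
    (h : Literature.AnabelianGeometry.AbsoluteAnabelian.AbsTopIII.Rmk_1_5_4_i.{0}) :
    ¬ ∀ M : IntrinsicKummerModel.{0},
        Literature.AnabelianGeometry.AbsoluteAnabelian.AbsTopIII.IntrinsicKummerModel.Prop_1_6_iii_units
          M :=
  not_forall_prop_1_6_iii_units_of_isKummerFaithful (isKummerFaithful_rat_of_rmk154i h)

/-- **F-0376, universal closure REFUTED modulo F-0369** (universe `0`, at `k = ℚ`).
[cite: MochizukiAbsTopIII2015, Prop 1.8 (i) p.36] -/
theorem not_forall_prop_1_8_i_units_of_rmk154i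
    (h : Literature.AnabelianGeometry.AbsoluteAnabelian.AbsTopIII.Rmk_1_5_4_i.{0}) :
    ¬ ∀ M : IntrinsicKummerModel.{0},
        Literature.AnabelianGeometry.AbsoluteAnabelian.AbsTopIII.IntrinsicKummerModel.Prop_1_8_i_units
          M :=
  not_forall_prop_1_8_i_units_of_isKummerFaithful (isKummerFaithful_rat_of_rmk154i h)

/-- **F-0377, universal closure REFUTED modulo F-0369** (universe `0`, at `k = ℚ`).
[cite: MochizukiAbsTopIII2015, Prop 1.8 (ii) p.36] -/
theorem not_forall_prop_1_8_ii_units_of_rmk154i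
    (h : Literature.AnabelianGeometry.AbsoluteAnabelian.AbsTopIII.Rmk_1_5_4_i.{0}) :
    ¬ ∀ M : IntrinsicKummerModel.{0},
        Literature.AnabelianGeometry.AbsoluteAnabelian.AbsTopIII.IntrinsicKummerModel.Prop_1_8_ii_units
          M :=
  not_forall_prop_1_8_ii_units_of_isKummerFaithful (isKummerFaithful_rat_of_rmk154i h)

/-! ### The instance forms at the DEGENERATE no-curve models -/

/-- F-0374 holds at every model with no curves (DEGENERATE instance; `exists_isEmpty_curve`).
[cite: MochizukiAbsTopIII2015, Prop 1.6 (i) p.34] -/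
theorem prop_1_6_i_of_isEmpty_curve (M : IntrinsicKummerModel.{u}) [IsEmpty M.Curve] :
    Literature.AnabelianGeometry.AbsoluteAnabelian.AbsTopIII.IntrinsicKummerModel.Prop_1_6_i M :=
  fun U => isEmptyElim U

/-- F-0375 holds at every model with no curves (DEGENERATE instance).
[cite: MochizukiAbsTopIII2015, Prop 1.6 (iii) p.35] -/
theorem prop_1_6_iii_units_of_isEmpty_curve (M : IntrinsicKummerModel.{u}) [IsEmpty M.Curve] :
    Literature.AnabelianGeometry.AbsoluteAnabelian.AbsTopIII.IntrinsicKummerModel.Prop_1_6_iii_units M :=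
  fun U => isEmptyElim U

/-- F-0376 holds at every model with no curves (DEGENERATE instance).
[cite: MochizukiAbsTopIII2015, Prop 1.8 (i) p.36] -/
theorem prop_1_8_i_units_of_isEmpty_curve (M : IntrinsicKummerModel.{u}) [IsEmpty M.Curve] :
    Literature.AnabelianGeometry.AbsoluteAnabelian.AbsTopIII.IntrinsicKummerModel.Prop_1_8_i_units M :=
  fun U => isEmptyElim U

/-- F-0377 holds at every model with no curves (DEGENERATE instance).
[cite: MochizukiAbsTopIII2015, Prop 1.8 (ii) p.36] -/
theorem prop_1_8_ii_units_of_isEmpty_curve (M : IntrinsicKummerModel.{u}) [IsEmpty M.Curve] :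
    Literature.AnabelianGeometry.AbsoluteAnabelian.AbsTopIII.IntrinsicKummerModel.Prop_1_8_ii_units M :=
  fun U => isEmptyElim U

/-- The four schemata are jointly satisfiable: they all hold at the no-curve model
(`IntrinsicKummerModel.exists_isEmpty_curve`; DEGENERATE). [cite: MochizukiAbsTopIII2015, Prop 1.6 p.34] -/
theorem exists_model_props :
    ∃ M : IntrinsicKummerModel.{u},
      M.Prop_1_6_i ∧ M.Prop_1_6_iii_units ∧ M.Prop_1_8_i_units ∧ M.Prop_1_8_ii_units := by
  obtain ⟨M, hM⟩ := IntrinsicKummerModel.exists_isEmpty_curve.{u}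
  exact ⟨M, prop_1_6_i_of_isEmpty_curve M, prop_1_6_iii_units_of_isEmpty_curve M,
    prop_1_8_i_units_of_isEmpty_curve M, prop_1_8_ii_units_of_isEmpty_curve M⟩

end IntrinsicKummerModel

end Literature.AnabelianGeometry.AbsoluteAnabelian.AbsTopIII
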